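import Mathlib
import HarnessLib
import Summits.Ventures.LatticeQCDFlow.Scoring.DoeblinEnvelopeSharp
import Summits.Ventures.LatticeQCDFlow.Scoring.ReplicaChains

/-!
# The burn-in bias that replicas cannot divide is real: for the lazy kernel the time average from a
# start `μ₀` has bias EXACTLY `(μ₀f − πf)(1 − (1−ε)^N)/(εN)`, and the grand mean of ANY number of
# streams has mean-square error at least its square

HONEST FRAMING: exact (Metropolis-corrected) sampling algorithms for lattice gauge theory;
figures of merit are autocorrelation/cost numbers at stated couplings and volumes; no
continuum-physics claim.

Venture `LatticeQCDFlow` (cell pub-lqcd), topic `Scoring`; FANOUT row 8 (`s0-cpn-nemc`, GEN-14).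
NEW WORK of the cell (elementary), not a published result; no definition is introduced.  Companion
(floor) of `Scoring/ReplicaChains.lean` and `Scoring/ReplicaChainsBurnIn.lean`, whose certified
mean-square error of the grand mean of `R` independent streams keeps the weight `1 − 1/R` on the
squared burn-in bias `(2C'/(εN))²`.  On the lazy kernel `κ(x, ·) = ε π + (1 − ε) δ_x` of
`Scoring/DoeblinEnvelopeSharp.lean` (Doeblin constant exactly `ε`, `π` invariant, `(kop κ)ᵗ f̄ =
(1 − ε)ᵗ f̄`) everything is explicit: the bias of the time average from any start is
`(μ₀f − πf)(1 − (1 − ε)^N)/(εN)`, of the same order `1/(εN)` as the certified ceiling, and by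
Jensen the grand mean of streams with this law — however many, however correlated — has
mean-square error at least the bias squared.  Inputs: `Scoring/ChainBurnIn.chain_expect`,
`lazy_iterate_kop`, `Scoring/KernelTransitionOperator.sq_integral_le_integral_sq`, row 11's
`replicaMean`.  Nothing is cited as a fact.

## Content (`κ` lazy with `0 < ε ≤ 1`; `P_{μ₀}` the chain from `μ₀`; `|f| ≤ C`; `N ≥ 1`)

* `lazy_chain_bias_eq` — `E_{μ₀}[f(X_t)] − πf = (1 − ε)ᵗ (μ₀f − πf)` for every `t`;
* `geom_sum_one_sub` — `Σ_{i<N} (1 − e)^i = (1 − (1 − e)^N)/e` (`e ≠ 0`);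
* **`lazy_chain_timeAverage_bias_eq`** —
  `E_{μ₀}[(1/N) Σ_{i<N} f(X_i)] − πf = (μ₀f − πf)(1 − (1 − ε)^N)/(εN)`;
* `integral_sub_sq_ge_sq` — Jensen: `(E Z − c)² ≤ E (Z − c)²` for bounded measurable `Z`;
* **`lazy_replicas_mse_ge`** — on any probability space carrying paths `X_0, …, X_{R−1}` (`R ≥ 1`,
  ANY joint law) each distributed as `P_{μ₀}`, the grand mean `Ȳ` of the stream time averages has
  `E[(Ȳ − πf)²] ≥ ((μ₀f − πf)(1 − (1 − ε)^N)/(εN))²`.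

Reading (value-free): take `μ₀ = δ_U` (a cold start) and an observable with `f(U) − πf = C'`; once
`N ≥ 1/ε` the floor is `≥ (C'(1 − e^{−1})/(εN))²`, so the undividable term `(1 − 1/R)(2C'/(εN))²` of
the replica ceiling is sharp in its dependence on `C'`, `ε`, `N` (constant within `4/(1 − e^{−1})²`)
and genuinely independent of `R`: more streams never substitute for kept length or a warm start.
NOT CLAIMED: that production samplers are lazy kernels (this is the extremal model of the
certificate); any number of ours.
-/

noncomputable section

namespace Summit.Ventures.LatticeQCDFlow.Scoring

open MeasureTheory ProbabilityTheory Filter Finset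
open scoped ENNReal

variable {Ω : Type*} [MeasurableSpace Ω]

section Lazy

variable {κ : Kernel Ω Ω} [IsMarkovKernel κ] {π : Measure Ω} [IsProbabilityMeasure π] {ε : ℝ≥0∞}
  {μ₀ : Measure Ω} [IsProbabilityMeasure μ₀]

/-- **Exact per-step bias of the lazy chain from any start**:
`E_{μ₀}[f(X_t)] − πf = (1 − ε)ᵗ (μ₀f − πf)`. -/
theorem lazy_chain_bias_eq (hκ : ∀ x, κ x = ε • π + (1 - ε) • Measure.dirac x) (hε1 : ε ≤ 1)
    {f : Ω → ℝ} (hf : Measurable f) {C : ℝ} (hC : ∀ x, |f x| ≤ C) (t : ℕ) :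
    ∫ x, f (x t) ∂(Kernel.trajMeasure (X := fun _ : ℕ => Ω) μ₀
        (fun n : ℕ => κ.comap (fun h : (i : ↥(Finset.Iic n)) → Ω => h ⟨n, Finset.mem_Iic.2 le_rfl⟩)
          (measurable_pi_apply _))) - ∫ x, f x ∂π
      = (1 - ε.toReal) ^ t * (∫ x, f x ∂μ₀ - ∫ x, f x ∂π) := by
  set m := ∫ x, f x ∂π with hm
  have hgm : Measurable fun y => f y - m := hf.sub measurable_const
  have hgb : ∀ y, |f y - m| ≤ C + |m| := fun y => (abs_sub _ _).trans (add_le_add (hC y) le_rfl)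
  have hg0 : ∫ y, (f y - m) ∂π = 0 := by
    rw [integral_sub (integrable_of_bounded π hf hC) (integrable_const _), integral_const,
      probReal_univ, one_smul, hm, sub_self]
  obtain ⟨hKm, hKb⟩ := iterate_kop_bounded_measurable κ hf hC t
  rw [chain_expect κ μ₀ hf hC t]
  have hshift := iterate_kop_sub_const (κ := κ) hf hC m t
  have hlazy := lazy_iterate_kop hκ hε1 hgm hgb hg0 t
  -- `∫ (kop κ)^[t] f dμ₀ − m = ∫ ((kop κ)^[t] f − m) dμ₀ = ∫ (kop κ)^[t] (f − m) dμ₀`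
  have h1 : ∫ x, (kop κ)^[t] f x ∂μ₀ - m = ∫ x, (kop κ)^[t] (fun y => f y - m) x ∂μ₀ := by
    rw [hshift, integral_sub (integrable_of_bounded μ₀ hKm hKb) (integrable_const _), integral_const,
      probReal_univ, one_smul]
  rw [h1, hlazy, integral_const_mul, integral_sub (integrable_of_bounded μ₀ hf hC)
    (integrable_const _), integral_const, probReal_univ, one_smul]

omit [MeasurableSpace Ω] in
/-- `Σ_{i<N} (1 − e)^i = (1 − (1 − e)^N)/e` for `e ≠ 0`. -/
theorem geom_sum_one_sub {e : ℝ} (he : e ≠ 0) (N : ℕ) :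
    ∑ i ∈ Finset.range N, (1 - e) ^ i = (1 - (1 - e) ^ N) / e := by
  have h1 : (1 : ℝ) - e ≠ 1 := by intro h; apply he; linarith
  rw [geom_sum_eq h1 N]
  have h2 : (1 : ℝ) - e - 1 = -e := by ring
  rw [h2, div_neg, neg_div', neg_sub]

/-- **Exact bias of the lazy chain's time average from any start** (`0 < ε ≤ 1`, `N ≥ 1`):
`E_{μ₀}[(1/N) Σ_{i<N} f(X_i)] − πf = (μ₀f − πf) (1 − (1 − ε)^N)/(ε N)`. -/
theorem lazy_chain_timeAverage_bias_eq (hκ : ∀ x, κ x = ε • π + (1 - ε) • Measure.dirac x)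
    (hε0 : 0 < ε) (hε1 : ε ≤ 1) {f : Ω → ℝ} (hf : Measurable f) {C : ℝ} (hC : ∀ x, |f x| ≤ C)
    {N : ℕ} (hN : N ≠ 0) :
    ∫ x, (∑ i ∈ Finset.range N, f (x i)) / N ∂(Kernel.trajMeasure (X := fun _ : ℕ => Ω) μ₀
        (fun n : ℕ => κ.comap (fun h : (i : ↥(Finset.Iic n)) → Ω => h ⟨n, Finset.mem_Iic.2 le_rfl⟩)
          (measurable_pi_apply _))) - ∫ x, f x ∂π
      = (∫ x, f x ∂μ₀ - ∫ x, f x ∂π) * (1 - (1 - ε.toReal) ^ N) / (ε.toReal * N) := by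
  set P := Kernel.trajMeasure (X := fun _ : ℕ => Ω) μ₀
      (fun n : ℕ => κ.comap (fun h : (i : ↥(Finset.Iic n)) → Ω => h ⟨n, Finset.mem_Iic.2 le_rfl⟩)
        (measurable_pi_apply _)) with hP
  set m := ∫ x, f x ∂π with hm
  have hεr0 : 0 < ε.toReal :=
    ENNReal.toReal_pos hε0.ne' (ne_top_of_le_ne_top ENNReal.one_ne_top hε1)
  have hNpos : (0 : ℝ) < N := by exact_mod_cast Nat.pos_of_ne_zero hN
  have hint : ∀ i, Integrable (fun x : ℕ → Ω => f (x i)) P := fun i =>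
    integrable_of_bounded P (hf.comp (measurable_pi_apply i)) fun x => hC (x i)
  have hstep : ∀ i, ∫ x, f (x i) ∂P - m = (1 - ε.toReal) ^ i * (∫ x, f x ∂μ₀ - m) := fun i => by
    rw [hP]; exact lazy_chain_bias_eq (μ₀ := μ₀) hκ hε1 hf hC i
  have hmean : ∫ x, (∑ i ∈ Finset.range N, f (x i)) / N ∂P
      = (∑ i ∈ Finset.range N, ∫ x, f (x i) ∂P) / N := by
    rw [integral_div, integral_finsetSum _ (fun i _ => hint i)]
  rw [hmean]
  have hsub : (∑ i ∈ Finset.range N, ∫ x, f (x i) ∂P) / N - m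
      = (∑ i ∈ Finset.range N, (∫ x, f (x i) ∂P - m)) / N := by
    rw [Finset.sum_sub_distrib, Finset.sum_const, Finset.card_range, nsmul_eq_mul]
    field_simp
  rw [hsub, Finset.sum_congr rfl fun i _ => hstep i, ← Finset.sum_mul,
    geom_sum_one_sub hεr0.ne' N]
  field_simp

end Lazy

/-! ### The replica floor -/

section Floor

variable {Ω' : Type*} {mΩ' : MeasurableSpace Ω'} {μ : Measure Ω'} [IsProbabilityMeasure μ]

/-- Jensen about a target: `(E Z − c)² ≤ E (Z − c)²` for bounded measurable `Z`. -/
theorem integral_sub_sq_ge_sq {Z : Ω' → ℝ} (hZ : Measurable Z) {C : ℝ} (hC : ∀ ω, |Z ω| ≤ C)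
    (c : ℝ) : (∫ ω, Z ω ∂μ - c) ^ 2 ≤ ∫ ω, (Z ω - c) ^ 2 ∂μ := by
  have h := sq_integral_le_integral_sq μ (g := fun ω => Z ω - c) (hZ.sub measurable_const)
    (C := C + |c|) fun ω => (abs_sub _ _).trans (add_le_add (hC ω) le_rfl)
  have hsub : ∫ ω, (Z ω - c) ∂μ = ∫ ω, Z ω ∂μ - c := by
    rw [integral_sub (integrable_of_bounded μ hZ hC) (integrable_const c), integral_const,
      probReal_univ, one_smul]
  rw [hsub] at h
  exact h

variable {κ : Kernel Ω Ω} [IsMarkovKernel κ] {π : Measure Ω} [IsProbabilityMeasure π] {ε : ℝ≥0∞}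
  {μ₀ : Measure Ω} [IsProbabilityMeasure μ₀] {X : ℕ → Ω' → (ℕ → Ω)} {R : ℕ}

/-- **THE BIAS FLOOR FOR ANY NUMBER OF STREAMS.**  `κ` lazy (`κ(x, ·) = ε π + (1 − ε) δ_x`,
`0 < ε ≤ 1`), `|f| ≤ C`, `N ≥ 1`, `R ≥ 1`; on any probability space carrying paths `X_0, …, X_{R−1}`
EACH distributed as the chain from `μ₀` (their joint law arbitrary), the grand mean `Ȳ` of the
stream time averages satisfies `((μ₀f − πf)(1 − (1−ε)^N)/(εN))² ≤ E[(Ȳ − πf)²]`. -/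
theorem lazy_replicas_mse_ge (hκ : ∀ x, κ x = ε • π + (1 - ε) • Measure.dirac x) (hε0 : 0 < ε)
    (hε1 : ε ≤ 1) {f : Ω → ℝ} (hf : Measurable f) {C : ℝ} (hC : ∀ x, |f x| ≤ C) {N : ℕ}
    (hN : N ≠ 0) (hR : R ≠ 0) (hXm : ∀ r, Measurable (X r))
    (hlaw : ∀ r < R, μ.map (X r) = Kernel.trajMeasure (X := fun _ : ℕ => Ω) μ₀
      (fun n : ℕ => κ.comap (fun h : (i : ↥(Finset.Iic n)) → Ω => h ⟨n, Finset.mem_Iic.2 le_rfl⟩)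
        (measurable_pi_apply _))) :
    ((∫ x, f x ∂μ₀ - ∫ x, f x ∂π) * (1 - (1 - ε.toReal) ^ N) / (ε.toReal * N)) ^ 2
      ≤ ∫ ω, (replicaMean (fun r ω => (∑ i ∈ Finset.range N, f (X r ω i)) / N) R ω
          - ∫ x, f x ∂π) ^ 2 ∂μ := by
  have hRpos : (0 : ℝ) < R := by exact_mod_cast Nat.pos_of_ne_zero hR
  have hAm : Measurable fun x : ℕ → Ω => (∑ i ∈ Finset.range N, f (x i)) / N :=
    measurable_timeAverage hf N
  have hAb : ∀ x : ℕ → Ω, |(∑ i ∈ Finset.range N, f (x i)) / N| ≤ C := fun x =>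
    abs_timeAverage_le hC hN x
  -- the grand mean is bounded and measurable
  have hYm : Measurable (replicaMean (fun r ω => (∑ i ∈ Finset.range N, f (X r ω i)) / N) R) := by
    unfold replicaMean
    exact (Finset.measurable_sum _ fun r _ => hAm.comp (hXm r)).div_const _
  have hYb : ∀ ω, |replicaMean (fun r ω => (∑ i ∈ Finset.range N, f (X r ω i)) / N) R ω| ≤ C := by
    intro ω
    unfold replicaMean
    rw [abs_div, abs_of_pos hRpos, div_le_iff₀ hRpos]
    calc |∑ r ∈ range R, (∑ i ∈ Finset.range N, f (X r ω i)) / N|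
        ≤ ∑ r ∈ range R, |(∑ i ∈ Finset.range N, f (X r ω i)) / N| := Finset.abs_sum_le_sum_abs _ _
      _ ≤ ∑ _r ∈ range R, C := Finset.sum_le_sum fun r _ => hAb (X r ω)
      _ = C * R := by rw [Finset.sum_const, Finset.card_range, nsmul_eq_mul, mul_comm]
  -- its mean is the common stream bias
  have hmeanr : ∀ r < R, ∫ ω, (∑ i ∈ Finset.range N, f (X r ω i)) / N ∂μ - ∫ x, f x ∂π
      = (∫ x, f x ∂μ₀ - ∫ x, f x ∂π) * (1 - (1 - ε.toReal) ^ N) / (ε.toReal * N) := by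
    intro r hr
    rw [integral_comp_eq_of_map_eq (hXm r) (hlaw r hr) hAm]
    exact lazy_chain_timeAverage_bias_eq (μ₀ := μ₀) hκ hε0 hε1 hf hC hN
  have hint : ∀ r ∈ range R, Integrable (fun ω => (∑ i ∈ Finset.range N, f (X r ω i)) / N) μ :=
    fun r _ => integrable_of_bounded μ (hAm.comp (hXm r)) fun ω => hAb (X r ω)
  have hmeanY : ∫ ω, replicaMean (fun r ω => (∑ i ∈ Finset.range N, f (X r ω i)) / N) R ω ∂μ
      - ∫ x, f x ∂π
      = (∫ x, f x ∂μ₀ - ∫ x, f x ∂π) * (1 - (1 - ε.toReal) ^ N) / (ε.toReal * N) := by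
    unfold replicaMean
    rw [integral_div, integral_finsetSum _ hint]
    have h : (∑ r ∈ range R, ∫ ω, (∑ i ∈ Finset.range N, f (X r ω i)) / N ∂μ) / R - ∫ x, f x ∂π
        = (∑ r ∈ range R, (∫ ω, (∑ i ∈ Finset.range N, f (X r ω i)) / N ∂μ - ∫ x, f x ∂π)) / R := by
      rw [Finset.sum_sub_distrib, Finset.sum_const, Finset.card_range, nsmul_eq_mul]
      field_simp
    rw [h, Finset.sum_congr rfl fun r hr => hmeanr r (mem_range.1 hr), Finset.sum_const,
      Finset.card_range, nsmul_eq_mul]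
    field_simp
  rw [← hmeanY]
  exact integral_sub_sq_ge_sq hYm hYb _

end Floor

end Summit.Ventures.LatticeQCDFlow.Scoring

end
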